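import Summits.CriticalPhenomena.CardyFormulaZ2.Theorems.CardyDualCurrentCanonicalLimitFromExactCRStubLimitHolomorphic
import Literature.Probability.LatticeModels.LatticeHarmonicCompactnessLocal

/-!
# Stub `stub_precompactOfBounded` (crux stmt-CriticalPhenomena-11394, line `registered`)

Precompactness from local bounds, for the observable of an exactly discrete-holomorphic local
parafermionic template: along meshes `δ_k → 0⁺` of a `ZdDiscretisationFamily E` of a Dobrushin
domain `D`, if `T` is exactly Cauchy–Riemann in `E δ_k` for all large `k` and the renormalised step
functions `c_k · T.obs (E δ_k) ⌊w/δ_k⌋ i` are bounded on each compact of `D` eventually-uniformly in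
`k`, then a subsequence converges uniformly on every compact of `D`, for both edge types `i`, to
continuous limits `g 0, g 1`.

This is Smirnov's precompactness step (Smirnov 2010, §5; Chelkak–Smirnov 2011, Prop. 3.1) for
templates, with the a priori bound kept as a hypothesis: exact CR at deep stencils makes the two
edge functions discrete harmonic (`sum_edgeFun_zero_sub`, `sum_edgeFun_one_sub`: Duffin), hence
their real and imaginary parts lattice-harmonic at deep sites; the local compactness theorem for
locally bounded, locally-eventually lattice-harmonic functions
(`exists_subseq_tendstoUniformlyOn_of_latticeHarmonic_local`, interior gradient estimate +
asymptotic Arzelà–Ascoli) extracts the subsequence, one real component at a time.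
-/

noncomputable section

namespace Summit.CriticalPhenomena.CardyFormulaZ2.Cruxes.CanonicalLimitFromExactCR.Birth

open scoped BigOperators Topology
open Filter Set Metric Complex
open Literature.Probability.LatticeModels Literature.Probability.RandomPlanarGeometry
open Literature.Probability.LatticeModels.DiscreteDobrushin (supNear supNear_self supNear_mono
  supNear_of_adj dist_meshPoint_le_of_supNear)

namespace Precompact

/-- Uniform convergence persists along subsequences. [folklore] -/
theorem tendstoUniformlyOn_subseq {F : ℕ → ℂ → ℝ} {f : ℂ → ℝ} {K : Set ℂ}
    (h : TendstoUniformlyOn F f atTop K) {φ : ℕ → ℕ} (hφ : StrictMono φ) :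
    TendstoUniformlyOn (fun k => F (φ k)) f atTop K := by
  rw [Metric.tendstoUniformlyOn_iff] at h ⊢
  exact fun ε hε => hφ.tendsto_atTop.eventually (h ε hε)

/-- A complex sequence of functions converges uniformly when its real and imaginary parts do.
[folklore] -/
theorem tendstoUniformlyOn_of_re_im {F : ℕ → ℂ → ℂ} {a b : ℂ → ℝ} {K : Set ℂ}
    (hre : TendstoUniformlyOn (fun k w => (F k w).re) a atTop K)
    (him : TendstoUniformlyOn (fun k w => (F k w).im) b atTop K) :
    TendstoUniformlyOn F (fun w => (a w : ℂ) + (b w : ℂ) * I) atTop K := by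
  rw [Metric.tendstoUniformlyOn_iff] at hre him ⊢
  intro ε hε
  filter_upwards [hre (ε / 2) (half_pos hε), him (ε / 2) (half_pos hε)] with k hk hk' w hw
  have h1 := hk w hw
  have h2 := hk' w hw
  rw [Real.dist_eq] at h1 h2
  rw [Complex.dist_eq]
  have e : ((a w : ℂ) + (b w : ℂ) * I) - F k w = ((a w - (F k w).re : ℝ) : ℂ) +
      ((b w - (F k w).im : ℝ) : ℂ) * I := by
    apply Complex.ext <;> simp
  rw [e]
  refine (Complex.norm_le_abs_re_add_abs_im _).trans_lt ?_
  simp only [add_re, ofReal_re, mul_re, I_re, mul_zero, ofReal_im, I_im, mul_one, sub_self,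
    add_zero, add_im, mul_im, zero_add]
  linarith

/-- **Exact CR at the deep stencils around `v` makes both renormalised edge functions satisfy the
five-point identity at `v`**, hence have lattice-harmonic real and imaginary parts there. [folklore] -/
theorem laplacian_eq_zero_of_isExactCRIn {T : LocalParafermionicTemplate} {Dd : DiscreteDobrushin}
    (hCR : T.IsExactCRIn Dd) (c : ℂ) {v : Site 2} (hv : ∀ z, supNear v 2 z → ∀ i, T.IsDeep Dd z i)
    (i : Fin 2) :
    latticeLaplacian (fun u => (c * T.obs Dd u i).re) v = 0 ∧
      latticeLaplacian (fun u => (c * T.obs Dd u i).im) v = 0 := by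
  set F := typedEdgeFun (T.obs Dd) with hF
  have hcr : ∀ y, supNear v 1 y → CRVertex F y ∧ CRFace F y := fun y hy =>
    LimitHolomorphic.cr_of_isExactCRIn hCR fun z hz i => hv z
      (fun j => by have h := (hy.trans hz) j; linarith) i
  have hs : ∀ k : Fin 4, supNear v 1 (v + cornerUnit k) := fun k j => by
    fin_cases j <;> fin_cases k <;> simp [cornerUnit]
  have hsm : ∀ k : Fin 4, supNear v 1 (v - cornerUnit k) := fun k j => by
    fin_cases j <;> fin_cases k <;> simp [cornerUnit]
  have h0 : supNear v 1 v := supNear_self v zero_le_one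
  apply latticeLaplacian_re_im_eq_zero
  fin_cases i
  · have key := sum_edgeFun_zero_sub (hcr v h0).1 (hcr _ (hs 0)).1 (hcr v h0).2 (hcr _ (hsm 1)).2
    simp only [edgeFun, hF, typedEdgeFun_cSrc_zero] at key
    show (∑ k : Fin 4, c * T.obs Dd (v + cornerUnit k) 0) - 4 * (c * T.obs Dd v 0) = 0
    rw [← Finset.mul_sum]
    linear_combination c * key
  · have key := sum_edgeFun_one_sub (hcr v h0).1 (hcr _ (hs 1)).1 (hcr v h0).2 (hcr _ (hsm 0)).2
    simp only [edgeFun, hF, typedEdgeFun_cSrc_one] at key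
    show (∑ k : Fin 4, c * T.obs Dd (v + cornerUnit k) 1) - 4 * (c * T.obs Dd v 1) = 0
    rw [← Finset.mul_sum]
    linear_combination c * key

/-- **One real component at a time.** For a template exactly CR in `E (s k)` eventually, with
`c k · T.obs` bounded at the sites of each compact eventually, the real-valued lattice functions
`v ↦ (component of) c k · T.obs (E (s k)) v i` satisfy the hypotheses of the local harmonic
compactness theorem: along a subsequence their floor-read step functions converge uniformly on
compacts of `D` to a continuous function. [folklore] -/
theorem exists_subseq_component {T : LocalParafermionicTemplate} {D : DobrushinDomain}
    {E : ℝ → DiscreteDobrushin} (hDE : ZdDiscretisationFamily D E) {s : ℕ → ℝ}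
    (hs0 : ∀ k, 0 < s k) (hs : Tendsto s atTop (𝓝 0))
    (hCR : ∀ᶠ k in atTop, T.IsExactCRIn (E (s k))) (c : ℕ → ℂ)
    (hbdd : ∀ K ⊆ D.carrier, IsCompact K → ∃ M : ℝ, ∀ᶠ k in atTop, ∀ (i : Fin 2) (v : Site 2),
      meshPoint (s k) v ∈ K → ‖c k * T.obs (E (s k)) v i‖ ≤ M)
    (P : ℕ → Site 2 → ℝ) (i : Fin 2)
    (hP : (∀ k v, P k v = (c k * T.obs (E (s k)) v i).re) ∨ (∀ k v, P k v = (c k * T.obs (E (s k)) v i).im)) :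
    ∃ φ : ℕ → ℕ, StrictMono φ ∧ ∃ H : ℂ → ℝ, ContinuousOn H D.carrier ∧
      ∀ K ⊆ D.carrier, IsCompact K →
        TendstoUniformlyOn (fun n z => P (φ n) (floorSite (s (φ n)) z)) H atTop K := by
  have hs' : Tendsto s atTop (𝓝[>] (0 : ℝ)) :=
    tendsto_nhdsWithin_iff.2 ⟨hs, Eventually.of_forall fun k => hs0 k⟩
  refine exists_subseq_tendstoUniformlyOn_of_latticeHarmonic_local D.isOpen hs0 hs P floorSite
    (fun hd z => dist_meshPoint_floorSite_le hd z) (fun K hKD hK => ?_) (fun K hKD hK => ?_)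
  · -- harmonicity at the sites of `K`, eventually
    obtain ⟨ρ, hρ, hdeep⟩ := LimitHolomorphic.exists_deep_radius hDE T.r hK hKD
    have hsmall : ∀ᶠ δ in 𝓝[>] (0 : ℝ), δ < ρ / 4 := nhdsWithin_le_nhds (Iio_mem_nhds (by positivity))
    filter_upwards [hs'.eventually (hdeep.and hsmall), hCR] with k hk hk' v hv
    have hvdeep : ∀ z, supNear v 2 z → ∀ i, T.IsDeep (E (s k)) z i := by
      intro z hz i'
      refine hk.1 v z hv ?_ i'
      have h1 := dist_meshPoint_le_of_supNear (hs0 k).le hz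
      push_cast at h1
      linarith [hk.2]
    have key := laplacian_eq_zero_of_isExactCRIn hk' (c k) hvdeep i
    rcases hP with hP | hP
    · have e : P k = fun u => (c k * T.obs (E (s k)) u i).re := funext (hP k)
      rw [e]; exact key.1
    · have e : P k = fun u => (c k * T.obs (E (s k)) u i).im := funext (hP k)
      rw [e]; exact key.2
  · -- boundedness at the sites of `K`, eventually
    obtain ⟨M, hM⟩ := hbdd K hKD hK
    refine ⟨M, ?_⟩
    filter_upwards [hM] with k hk v hv
    rcases hP with hP | hP
    · rw [hP]; exact (abs_re_le_norm _).trans (hk i v hv)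
    · rw [hP]; exact (abs_im_le_norm _).trans (hk i v hv)

/-- **Precompactness from local bounds for an exactly-CR template** (Smirnov 2010 §5 /
Chelkak–Smirnov 2011 Prop. 3.1, for templates, a priori bound as hypothesis).
[cite: Smirnov2010, §5 (precompactness)] -/
theorem exists_subseq_of_bounded (T : LocalParafermionicTemplate) {D : DobrushinDomain}
    {E : ℝ → DiscreteDobrushin} (hDE : ZdDiscretisationFamily D E) {s : ℕ → ℝ}
    (hs : Tendsto s atTop (𝓝[>] (0 : ℝ))) (hCR : ∀ᶠ k in atTop, T.IsExactCRIn (E (s k)))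
    (c : ℕ → ℂ)
    (hbdd : ∀ (K : Set ℂ), K ⊆ D.carrier → IsCompact K → ∃ M : ℝ, ∀ᶠ k in atTop, ∀ (i : Fin 2),
      ∀ w ∈ K, ‖c k * T.obs (E (s k)) (fun j => ⌊(if j = 0 then w.re else w.im) / s k⌋) i‖ ≤ M) :
    ∃ φ : ℕ → ℕ, StrictMono φ ∧ ∃ g : Fin 2 → ℂ → ℂ, (∀ i, ContinuousOn (g i) D.carrier) ∧
      ∀ (i : Fin 2) (K : Set ℂ), K ⊆ D.carrier → IsCompact K →
        TendstoUniformlyOn (fun (k : ℕ) (w : ℂ) => c (φ k) *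
          T.obs (E (s (φ k))) (fun j => ⌊(if j = 0 then w.re else w.im) / s (φ k)⌋) i) (g i) atTop K := by
  -- shift to positive meshes
  obtain ⟨k₀, hk₀⟩ := eventually_atTop.1 (hs.eventually (self_mem_nhdsWithin :
    ∀ᶠ δ in 𝓝[>] (0 : ℝ), 0 < δ))
  set s' : ℕ → ℝ := fun k => s (k + k₀) with hs'def
  set c' : ℕ → ℂ := fun k => c (k + k₀) with hc'def
  have hs'0 : ∀ k, 0 < s' k := fun k => hk₀ (k + k₀) (Nat.le_add_left _ _)
  have hsh : Tendsto (fun k => k + k₀) atTop atTop := tendsto_add_atTop_nat k₀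
  have hs'lim : Tendsto s' atTop (𝓝 0) := (hs.mono_right nhdsWithin_le_nhds).comp hsh
  have hCR' : ∀ᶠ k in atTop, T.IsExactCRIn (E (s' k)) := hsh.eventually hCR
  -- bounds at sites
  have hbdd' : ∀ K ⊆ D.carrier, IsCompact K → ∃ M : ℝ, ∀ᶠ k in atTop, ∀ (i : Fin 2) (v : Site 2),
      meshPoint (s' k) v ∈ K → ‖c' k * T.obs (E (s' k)) v i‖ ≤ M := by
    intro K hKD hK
    obtain ⟨M, hM⟩ := hbdd K hKD hK
    refine ⟨M, ?_⟩
    filter_upwards [hsh.eventually hM] with k hk i v hv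
    have h : ‖c' k * T.obs (E (s' k)) (floorSite (s' k) (meshPoint (s' k) v)) i‖ ≤ M :=
      hk i (meshPoint (s' k) v) hv
    rwa [floorSite_meshPoint (hs'0 k).ne' v] at h
  -- four extractions
  have hgen : ∀ (ψ : ℕ → ℕ), StrictMono ψ → ∀ (i : Fin 2) (P : ℕ → Site 2 → ℝ),
      ((∀ k v, P k v = (c' k * T.obs (E (s' k)) v i).re) ∨
        (∀ k v, P k v = (c' k * T.obs (E (s' k)) v i).im)) →
      ∃ φ : ℕ → ℕ, StrictMono φ ∧ ∃ H : ℂ → ℝ, ContinuousOn H D.carrier ∧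
        ∀ K ⊆ D.carrier, IsCompact K →
          TendstoUniformlyOn (fun n z => P (ψ (φ n)) (floorSite (s' (ψ (φ n))) z)) H atTop K := by
    intro ψ hψ i P hP
    have hψt := hψ.tendsto_atTop
    have h := exists_subseq_component (T := T) hDE (s := s' ∘ ψ) (fun k => hs'0 (ψ k))
      (hs'lim.comp hψt) (hψt.eventually hCR') (c' ∘ ψ)
      (fun K hKD hK => by
        obtain ⟨M, hM⟩ := hbdd' K hKD hK
        exact ⟨M, hψt.eventually hM⟩)
      (fun k => P (ψ k)) i
      (by rcases hP with hP | hP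
          · exact Or.inl fun k v => hP (ψ k) v
          · exact Or.inr fun k v => hP (ψ k) v)
    exact h
  obtain ⟨φ₁, hφ₁, H₁, hH₁, hc₁⟩ := hgen id strictMono_id 0 _ (Or.inl fun k v => rfl)
  obtain ⟨φ₂, hφ₂, H₂, hH₂, hc₂⟩ := hgen φ₁ hφ₁ 0 _ (Or.inr fun k v => rfl)
  obtain ⟨φ₃, hφ₃, H₃, hH₃, hc₃⟩ := hgen (φ₁ ∘ φ₂) (hφ₁.comp hφ₂) 1 _ (Or.inl fun k v => rfl)
  obtain ⟨φ₄, hφ₄, H₄, hH₄, hc₄⟩ :=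
    hgen (φ₁ ∘ φ₂ ∘ φ₃) ((hφ₁.comp hφ₂).comp hφ₃) 1 _ (Or.inr fun k v => rfl)
  set Φ : ℕ → ℕ := fun k => φ₁ (φ₂ (φ₃ (φ₄ k))) + k₀ with hΦ
  have hΦm : StrictMono Φ := fun a b hab => by
    simp only [hΦ]
    exact Nat.add_lt_add_right (hφ₁ (hφ₂ (hφ₃ (hφ₄ hab)))) k₀
  refine ⟨Φ, hΦm, fun i => if i = 0 then fun w => (H₁ w : ℂ) + (H₂ w : ℂ) * I
    else fun w => (H₃ w : ℂ) + (H₄ w : ℂ) * I, fun i => ?_, fun i K hKD hK => ?_⟩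
  · fin_cases i
    · simp only [Fin.zero_eta, Fin.isValue, ↓reduceIte]
      exact (continuous_ofReal.comp_continuousOn hH₁).add
        ((continuous_ofReal.comp_continuousOn hH₂).mul continuousOn_const)
    · simp only [Fin.mk_one, Fin.isValue, one_ne_zero, ↓reduceIte]
      exact (continuous_ofReal.comp_continuousOn hH₃).add
        ((continuous_ofReal.comp_continuousOn hH₄).mul continuousOn_const)
  · fin_cases i
    · simp only [Fin.zero_eta, Fin.isValue, ↓reduceIte]
      refine tendstoUniformlyOn_of_re_im ?_ ?_
      · have h := tendstoUniformlyOn_subseq (tendstoUniformlyOn_subseq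
          (tendstoUniformlyOn_subseq (hc₁ K hKD hK) hφ₂) hφ₃) hφ₄
        exact h
      · have h := tendstoUniformlyOn_subseq (tendstoUniformlyOn_subseq (hc₂ K hKD hK) hφ₃) hφ₄
        exact h
    · simp only [Fin.mk_one, Fin.isValue, one_ne_zero, ↓reduceIte]
      refine tendstoUniformlyOn_of_re_im ?_ ?_
      · exact tendstoUniformlyOn_subseq (hc₃ K hKD hK) hφ₄
      · exact hc₄ K hKD hK

end Precompact

/-! ### The registered stub -/

/-- stub `stub_precompactOfBounded` (precompactness from local bounds; Smirnov 2010 §5 /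
Chelkak–Smirnov 2011 Prop. 3.1 for exactly-CR templates): for every template `T`, Dobrushin domain
`D`, `ZdDiscretisationFamily E`, sequence of meshes `s k → 0⁺` along which `T` is exactly CR in
`E (s k)` eventually, and normalisers `c k` such that `c k · T.obs (E (s k)) ⌊w/s k⌋ i` is bounded
on each compact of `D` eventually-uniformly in `k` (both `i`), some subsequence converges, for both
edge types, uniformly on every compact of `D` to continuous limits. -/
theorem stub_precompactOfBounded :
    (∀ (T : Literature.Probability.LatticeModels.LocalParafermionicTemplate) (D : Literature.Probability.RandomPlanarGeometry.DobrushinDomain) (E : ℝ → Literature.Probability.LatticeModels.DiscreteDobrushin), Literature.Probability.LatticeModels.ZdDiscretisationFamily D E → ∀ (s : ℕ → ℝ), Filter.Tendsto s Filter.atTop (𝓝[>] (0 : ℝ)) → (∀ᶠ k in Filter.atTop, T.IsExactCRIn (E (s k))) → ∀ (c : ℕ → ℂ), (∀ (K : Set ℂ), K ⊆ D.carrier → IsCompact K → ∃ M : ℝ, ∀ᶠ k in Filter.atTop, ∀ (i : Fin 2), ∀ w ∈ K, ‖c k * T.obs (E (s k)) (fun j => ⌊(if j = 0 then w.re else w.im)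 / s k⌋) i‖ ≤ M) → ∃ φ : ℕ → ℕ, StrictMono φ ∧ ∃ g : Fin 2 → ℂ → ℂ, (∀ i, ContinuousOn (g i) D.carrier) ∧ ∀ (i : Fin 2) (K : Set ℂ), K ⊆ D.carrier → IsCompact K → TendstoUniformlyOn (fun (k : ℕ) (w : ℂ) => c (φ k) * T.obs (E (s (φ k))) (fun j => ⌊(if j = 0 then w.re else w.im) / s (φ k)⌋) i) (g i) Filter.atTop K) := by
  intro T D E hDE s hs hCR c hbdd
  exact Precompact.exists_subseq_of_bounded T hDE hs hCR c hbdd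

end Summit.CriticalPhenomena.CardyFormulaZ2.Cruxes.CanonicalLimitFromExactCR.Birth

end
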